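import Summits.AtomisticToContinuum.Crystallization.Theorems.FrustratedLawDichotomyCollarNonExempt
import Summits.AtomisticToContinuum.Crystallization.Theorems.FrustratedLawDichotomyPeriodicBlockKernel

/-!
# FrustratedLawDichotomy · crux `AperiodicFrustratedLawGap` (stmt-AtomisticToContinuum-27623) — the collared non-exemption of INTERIOR BLOCK
# SITES from class-centre certificates of the supercell motif (decomp-a2c, prover hand 2, generation 16; critic rows 577 (5)(c) / 578 (B))

Companion of `…CollarNonExempt` (site certificates) and `…ExemptLocOptLocal` (the same transport for `LocOptLoc`).  The two tests of the
exemption of record, `MoveUnstableCore ε Rm s` and `RemovalUnstableCore eUp t Rm`, read only the centre and the POINT SET of atoms within `Rm`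
of it; so they are TRANSPORTED along any translation matching these point sets (§1, for injective configurations), and in the periodic
setting of the block kernels (cell `x, a`, dual basis `b`, `‖b_j‖ ≤ cB`, motif diameter `diam`, supercell motif `superMotif x a μ σ` enumerating
all `|σ|_∞ ≤ k₀`, class centres `cidx`) ONE margin `cB·(r + Rm + diam) < k₀ + 1` makes every site within `r` of an interior block site a translate —
WITH its `Rm`-neighbourhood — of a class centre of the supercell motif (§2).  Hence (§3) ★ `not_collarCore_block_of_classCerts`: if every class
centre of the supercell motif passes both tests, NO interior site of ANY block (any size, any re-indexing) is `CollarCore r eUp ε Rm s t`-exempt —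
literally the binder `hnex` of `…PeriodicBlockFlagsX.not_pairLevelLawX_of_cell_flags` for `Ex := CollarCore r eUp ε Rm s t`.
All `[folklore]`; 0 sorry.
-/

noncomputable section

namespace Summit.AtomisticToContinuum.Crystallization.Theorems.FrustratedLawDichotomyCollarNonExemptBlock

open Metric
open scoped BigOperators Classical
open Literature.MathematicalPhysics.StatisticalMechanics (lennardJones)
open Summit.AtomisticToContinuum.Crystallization.Theorems.ChargedEnergyGapNegative (E3)
open Summit.AtomisticToContinuum.Crystallization.Theorems.FrustratedLawDichotomyAveragingCut (ball mem_ball)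
open Summit.AtomisticToContinuum.Crystallization.Theorems.FrustratedLawDichotomyExemptMove (tsum_range_inter_eq_sum_filter)
open Summit.AtomisticToContinuum.Crystallization.Theorems.FrustratedLawDichotomyExemptAbsorptionRecord
  (MoveUnstableCore RemovalUnstableCore NonEquilibriumCore)
open Summit.AtomisticToContinuum.Crystallization.Theorems.FrustratedLawDichotomyCollarCensus (Collar CollarCore)
open Summit.AtomisticToContinuum.Crystallization.Theorems.FrustratedLawDichotomyCollarNonExempt (not_collarCore_of_forall)
open Summit.AtomisticToContinuum.Crystallization.Theorems.FrustratedLawDichotomyPeriodicBlockGeometry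
  (latVec latVec_add latVec_sub latVec_zero abs_coord_le_of_dual' range_reindex)
open Summit.AtomisticToContinuum.Crystallization.Theorems.FrustratedLawDichotomyPeriodicBlockKernel

/-! ## §1. Transport of the two tests along a translation matching the `Rm`-neighbourhoods -/

/-- The local index set of the two tests as a point set (injective configuration). [folklore] -/
theorem localSum_eq_tsum {N : ℕ} {y : Fin N → E3} (hy : Function.Injective y) (k : Fin N) (Rm : ℝ) (g : E3 → ℝ) :
    ∑ k' ∈ (Finset.univ.erase k).filter (fun k' => dist (y k') (y k) ≤ Rm), g (y k') =
      ∑' q : ↥(Set.range y ∩ {p | p ≠ y k ∧ dist p (y k) ≤ Rm}), g q := by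
  rw [tsum_range_inter_eq_sum_filter hy {p | p ≠ y k ∧ dist p (y k) ≤ Rm} g]
  refine Finset.sum_congr ?_ fun _ _ => rfl
  ext k'
  simp only [Finset.mem_filter, Finset.mem_erase, Finset.mem_univ, true_and, and_true, Set.mem_setOf_eq, hy.ne_iff]

/-- ★ **Local sums transport**: if `y k = z q + w`, every atom of `y` within `Rm` of `y k` is a `w`-translate of an atom of `z`, and every atom of `z`
within `Rm` of `z q` translates into `y` (both configurations injective), then `Σ_{y-atoms within Rm of y k} g = Σ_{z-atoms within Rm of z q} g(· + w)`.
[folklore] -/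
theorem localSum_transport {Rm : ℝ} {N M : ℕ} {y : Fin N → E3} {z : Fin M → E3} (hy : Function.Injective y) (hz : Function.Injective z)
    {k : Fin N} {q : Fin M} (w : E3) (hk : y k = z q + w)
    (hball : ∀ p ∈ Set.range y, dist p (y k) ≤ Rm → p - w ∈ Set.range z)
    (hmotif : ∀ p ∈ Set.range z, dist p (z q) ≤ Rm → p + w ∈ Set.range y) (g : E3 → ℝ) :
    ∑ k' ∈ (Finset.univ.erase k).filter (fun k' => dist (y k') (y k) ≤ Rm), g (y k') =
      ∑ q' ∈ (Finset.univ.erase q).filter (fun q' => dist (z q') (z q) ≤ Rm), g (z q' + w) := by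
  rw [localSum_eq_tsum hy k Rm g, localSum_eq_tsum hz q Rm (fun p => g (p + w))]
  set A : Set E3 := Set.range y ∩ {p | p ≠ y k ∧ dist p (y k) ≤ Rm} with hA
  set A' : Set E3 := Set.range z ∩ {p | p ≠ z q ∧ dist p (z q) ≤ Rm} with hA'
  have hzq : z q = y k - w := by rw [hk, add_sub_cancel_right]
  have hdist : ∀ p : E3, dist (p - w) (z q) = dist p (y k) := fun p => by rw [hzq, dist_sub_right]
  have hAA' : A = (fun p => p + w) '' A' := by
    ext p
    constructor
    · rintro ⟨hpy, hpne, hpd⟩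
      refine ⟨p - w, ⟨hball p hpy hpd, ?_, ?_⟩, sub_add_cancel p w⟩
      · intro h
        exact hpne (by rw [hzq] at h; exact sub_left_injective h)
      · rw [hdist]; exact hpd
    · rintro ⟨p', ⟨hp'z, hp'ne, hp'd⟩, rfl⟩
      refine ⟨hmotif p' hp'z hp'd, ?_, ?_⟩
      · intro h
        apply hp'ne
        rw [hzq, eq_sub_iff_add_eq]; exact h
      · rw [← hdist, add_sub_cancel_right]; exact hp'd
  let eqv : ↥A' ≃ ↥A := (Equiv.Set.image (fun p => p + w) A' (add_left_injective w)).trans (Equiv.setCongr hAA'.symm)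
  rw [← eqv.tsum_eq]
  exact tsum_congr fun _ => rfl

/-- ★ **The move test transports** (hypotheses of `localSum_transport`). [folklore] -/
theorem moveUnstableCore_transport {ε Rm s : ℝ} {N M : ℕ} {y : Fin N → E3} {z : Fin M → E3} (hy : Function.Injective y)
    (hz : Function.Injective z) {k : Fin N} {q : Fin M} (w : E3) (hk : y k = z q + w)
    (hball : ∀ p ∈ Set.range y, dist p (y k) ≤ Rm → p - w ∈ Set.range z)
    (hmotif : ∀ p ∈ Set.range z, dist p (z q) ≤ Rm → p + w ∈ Set.range y)
    (h : MoveUnstableCore ε Rm s N y k) : MoveUnstableCore ε Rm s M z q := by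
  unfold MoveUnstableCore at h ⊢
  obtain ⟨p, hps, hp7, hlt⟩ := h
  have hzq : z q = y k - w := by rw [hk, add_sub_cancel_right]
  have hd : dist (p - w) (z q) = dist p (y k) := by rw [hzq, dist_sub_right]
  refine ⟨p - w, by rw [hd]; exact hps, by rw [hd]; exact hp7, ?_⟩
  have e1 := localSum_transport hy hz w hk hball hmotif (fun q' => lennardJones (dist p q'))
  have e2 := localSum_transport hy hz w hk hball hmotif (fun q' => lennardJones (dist (y k) q'))
  have e1' : ∑ q' ∈ (Finset.univ.erase q).filter (fun q' => dist (z q') (z q) ≤ Rm), lennardJones (dist p (z q' + w)) =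
      ∑ q' ∈ (Finset.univ.erase q).filter (fun q' => dist (z q') (z q) ≤ Rm), lennardJones (dist (p - w) (z q')) :=
    Finset.sum_congr rfl fun q' _ => by rw [← dist_sub_right p (z q' + w) w, add_sub_cancel_right]
  have e2' : ∑ q' ∈ (Finset.univ.erase q).filter (fun q' => dist (z q') (z q) ≤ Rm), lennardJones (dist (y k) (z q' + w)) =
      ∑ q' ∈ (Finset.univ.erase q).filter (fun q' => dist (z q') (z q) ≤ Rm), lennardJones (dist (z q) (z q')) :=
    Finset.sum_congr rfl fun q' _ => by rw [hk, dist_add_right]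
  rw [e1, e1'] at hlt
  rw [e2, e2'] at hlt
  exact hlt

/-- ★ **The removal test transports** (hypotheses of `localSum_transport`). [folklore] -/
theorem removalUnstableCore_transport {eUp t Rm : ℝ} {N M : ℕ} {y : Fin N → E3} {z : Fin M → E3} (hy : Function.Injective y)
    (hz : Function.Injective z) {k : Fin N} {q : Fin M} (w : E3) (hk : y k = z q + w)
    (hball : ∀ p ∈ Set.range y, dist p (y k) ≤ Rm → p - w ∈ Set.range z)
    (hmotif : ∀ p ∈ Set.range z, dist p (z q) ≤ Rm → p + w ∈ Set.range y)
    (h : RemovalUnstableCore eUp t Rm N y k) : RemovalUnstableCore eUp t Rm M z q := by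
  unfold RemovalUnstableCore at h ⊢
  have e2 := localSum_transport hy hz w hk hball hmotif (fun q' => lennardJones (dist (y k) q'))
  have e2' : ∑ q' ∈ (Finset.univ.erase q).filter (fun q' => dist (z q') (z q) ≤ Rm), lennardJones (dist (y k) (z q' + w)) =
      ∑ q' ∈ (Finset.univ.erase q).filter (fun q' => dist (z q') (z q) ≤ Rm), lennardJones (dist (z q) (z q')) :=
    Finset.sum_congr rfl fun q' _ => by rw [hk, dist_add_right]
  rw [e2, e2'] at h
  exact h

/-! ## §2. Periodic geometry: atoms of the infinite configuration near a class centre are supercell-motif atoms -/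

/-- ★ Every atom `x m' + latVec a s` of the periodic configuration within `ρ` of the class centre `x m` is an atom of the supercell motif, provided
`cB·(ρ + diam) < k₀ + 1` and `(μ, σ)` enumerates all `|s|_∞ ≤ k₀`. [folklore] -/
theorem mem_range_superMotif_of_dist_le {N₀ M k₀ : ℕ} {x : Fin N₀ → E3} {a b : Fin 3 → E3} {cB ρ diam : ℝ}
    (hdual : ∀ j k, inner ℝ (b j) (a k) = if j = k then (1 : ℝ) else 0) (hb : ∀ j, ‖b j‖ ≤ cB) (hdiam : DiamLE x diam)
    (hk₀ : cB * (ρ + diam) < k₀ + 1) {μ : Fin M → Fin N₀} {σ : Fin M → Fin 3 → ℤ}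
    (hsup : ∀ (m : Fin N₀) (s : Fin 3 → ℤ), (∀ k, |s k| ≤ k₀) → ∃ q, μ q = m ∧ σ q = s)
    (m m' : Fin N₀) (s : Fin 3 → ℤ) (hp : dist (x m' + latVec a s) (x m) ≤ ρ) :
    x m' + latVec a s ∈ Set.range (superMotif x a μ σ) := by
  have hcB : 0 ≤ cB := (norm_nonneg _).trans (hb 0)
  have hnorm : ‖latVec a s‖ ≤ ρ + diam := by
    have h1 : dist (x m' + latVec a s) (x m) = ‖(x m' - x m) + latVec a s‖ := by
      rw [dist_eq_norm]; congr 1; abel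
    rw [h1] at hp
    have h2 : ‖latVec a s‖ ≤ ‖(x m' - x m) + latVec a s‖ + ‖x m' - x m‖ := by
      have := norm_sub_le ((x m' - x m) + latVec a s) (x m' - x m)
      rwa [add_sub_cancel_left] at this
    linarith [hdiam m' m]
  have hsk : ∀ k, |s k| ≤ k₀ := by
    intro k
    have h1 := abs_coord_le_of_dual' hdual hb s k
    have h2 : |((s k : ℤ) : ℝ)| < k₀ + 1 := by
      calc |((s k : ℤ) : ℝ)| ≤ cB * ‖latVec a s‖ := h1
        _ ≤ cB * (ρ + diam) := mul_le_mul_of_nonneg_left hnorm hcB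
        _ < k₀ + 1 := hk₀
    have h3 : |s k| < (k₀ : ℤ) + 1 := by
      have : ((|s k| : ℤ) : ℝ) < (k₀ : ℝ) + 1 := by rw [Int.cast_abs]; exact h2
      exact_mod_cast this
    omega
  obtain ⟨q, hq1, hq2⟩ := hsup m' s hsk
  exact ⟨q, by simp only [superMotif, hq1, hq2]⟩

/-- Atoms of the supercell motif and of blocks are atoms of the periodic configuration (normal forms). [folklore] -/
theorem superMotif_apply {N₀ M : ℕ} (x : Fin N₀ → E3) (a : Fin 3 → E3) (μ : Fin M → Fin N₀) (σ : Fin M → Fin 3 → ℤ) (q : Fin M) :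
    superMotif x a μ σ q = x (μ q) + latVec a (σ q) := rfl

/-! ## §3. Interior block sites inherit the class-centre certificates -/

/-- ★★ **TRANSPORT TO INTERIOR BLOCK SITES**: with the cell data of the block kernels and the single margin `cB·(r + Rm + diam) < k₀ + 1`
(`0 ≤ r`), every block site `k` within `r` of an interior site `(m, t)` satisfies, for SOME class `m'` and translation `w`,
`y k = superMotif (cidx m') + w` together with the two matching hypotheses of `localSum_transport` at radius `Rm`. [folklore] -/
theorem exists_class_transport {N₀ M k₀ n N : ℕ} {x : Fin N₀ → E3} {a b : Fin 3 → E3} {cB r Rm diam : ℝ}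
    (hdual : ∀ j k, inner ℝ (b j) (a k) = if j = k then (1 : ℝ) else 0) (hb : ∀ j, ‖b j‖ ≤ cB) (hdiam : DiamLE x diam)
    (hr : 0 ≤ r) (hk₀ : cB * (r + Rm + diam) < k₀ + 1) {μ : Fin M → Fin N₀} {σ : Fin M → Fin 3 → ℤ}
    (hσ : ∀ q k, |σ q k| ≤ k₀) (hsup : ∀ (m : Fin N₀) (s : Fin 3 → ℤ), (∀ k, |s k| ≤ k₀) → ∃ q, μ q = m ∧ σ q = s)
    {cidx : Fin N₀ → Fin M} (hc : ∀ m, μ (cidx m) = m ∧ σ (cidx m) = 0)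
    (e : (Fin N₀ × (Fin 3 → Fin n)) ≃ Fin N) {m : Fin N₀} {t : Fin 3 → Fin n} (ht : Interior k₀ n t) {k : Fin N}
    (hk : dist ((block x a n ∘ e.symm) k) ((block x a n ∘ e.symm) (e (m, t))) ≤ r) :
    ∃ (m' : Fin N₀) (w : E3), (block x a n ∘ e.symm) k = superMotif x a μ σ (cidx m') + w ∧
      (∀ p ∈ Set.range (block x a n ∘ e.symm), dist p ((block x a n ∘ e.symm) k) ≤ Rm → p - w ∈ Set.range (superMotif x a μ σ)) ∧
      (∀ p ∈ Set.range (superMotif x a μ σ), dist p (superMotif x a μ σ (cidx m')) ≤ Rm → p + w ∈ Set.range (block x a n ∘ e.symm)) := by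
  have hcB : 0 ≤ cB := (norm_nonneg _).trans (hb 0)
  have hdiam0 : 0 ≤ diam := (norm_nonneg _).trans (hdiam m m)
  -- normal form of the site `k`
  obtain ⟨m₁, t₁⟩ := e.symm k
  set y := block x a n ∘ e.symm with hy
  have hsite : y (e (m, t)) = x m + latVec a (tvec t) := by
    rw [hy, Function.comp_apply, Equiv.symm_apply_apply]; rfl
  have hyk : y k = x (e.symm k).1 + latVec a (tvec (e.symm k).2) := rfl
  have hcentre : ∀ m', superMotif x a μ σ (cidx m') = x m' := fun m' => by
    rw [superMotif_apply, (hc m').1, (hc m').2, latVec_zero, add_zero]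
  -- the translation: `w = latVec a (tvec (e.symm k).2)`, class `m' = (e.symm k).1`
  refine ⟨(e.symm k).1, latVec a (tvec (e.symm k).2), by rw [hcentre]; exact hyk, ?_, ?_⟩
  · -- block atoms within `Rm` of `y k` are translates of supercell-motif atoms (margin `cB (Rm + diam) < k₀ + 1`)
    intro p hp hpd
    rw [hy, range_reindex] at hp
    obtain ⟨⟨m₂, t₂⟩, rfl⟩ := hp
    have hk₀' : cB * (Rm + diam) < k₀ + 1 := by nlinarith
    have e1 : block x a n (m₂, t₂) - latVec a (tvec (e.symm k).2) = x m₂ + latVec a (tvec t₂ - tvec (e.symm k).2) := by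
      simp only [block, latVec_sub]; abel
    rw [e1]
    refine mem_range_superMotif_of_dist_le hdual hb hdiam hk₀' hsup (e.symm k).1 m₂ _ ?_
    have : dist (x m₂ + latVec a (tvec t₂ - tvec (e.symm k).2)) (x (e.symm k).1) = dist (block x a n (m₂, t₂)) (y k) := by
      rw [hyk, ← dist_add_right _ _ (latVec a (tvec (e.symm k).2)), latVec_sub]
      have e3 : x m₂ + (latVec a (tvec t₂) - latVec a (tvec (e.symm k).2)) + latVec a (tvec (e.symm k).2) = block x a n (m₂, t₂) := by
        simp only [block]; abel
      rw [e3]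
    rw [this]; exact hpd
  · -- supercell-motif atoms within `Rm` of the class centre translate into the block (margin `cB (r + Rm + diam)`)
    intro p hp hpd
    obtain ⟨q₂, rfl⟩ := hp
    rw [hcentre] at hpd
    -- `superMotif q₂ + latVec (tvec k.2) - latVec (tvec t)` is within `r + Rm` of `x m`, hence a supercell-motif atom; then translate by `tvec t`
    have hyk' : dist (y k) (x m + latVec a (tvec t)) ≤ r := by rw [← hsite]; exact hk
    have hin : x (μ q₂) + latVec a (σ q₂ + tvec (e.symm k).2 - tvec t) ∈ Set.range (superMotif x a μ σ) := by
      refine mem_range_superMotif_of_dist_le hdual hb hdiam hk₀ hsup m (μ q₂) _ ?_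
      have e1 : x (μ q₂) + latVec a (σ q₂ + tvec (e.symm k).2 - tvec t) =
          (superMotif x a μ σ q₂ + latVec a (tvec (e.symm k).2)) - latVec a (tvec t) := by
        simp only [superMotif_apply, latVec_add, latVec_sub]; abel
      rw [e1, dist_comm, ← dist_add_right _ _ (latVec a (tvec t)), sub_add_cancel, dist_comm]
      calc dist (superMotif x a μ σ q₂ + latVec a (tvec (e.symm k).2)) (x m + latVec a (tvec t))
          ≤ dist (superMotif x a μ σ q₂ + latVec a (tvec (e.symm k).2)) (y k) + dist (y k) (x m + latVec a (tvec t)) := dist_triangle _ _ _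
        _ ≤ Rm + r := by
            refine add_le_add ?_ hyk'
            rw [hyk, dist_add_right]; exact hpd
        _ = r + Rm := add_comm _ _
    obtain ⟨q₃, hq₃⟩ := hin
    have e2 : superMotif x a μ σ q₂ + latVec a (tvec (e.symm k).2) = superMotif x a μ σ q₃ + latVec a (tvec t) := by
      rw [hq₃, superMotif_apply, latVec_sub, latVec_add]; abel
    rw [e2, hy, range_reindex]
    exact superMotif_add_mem_range_block x a hσ ht q₃

/-- ★★★ **`hnex` for the collared exemption of record from CLASS-CENTRE CERTIFICATES**: if every class centre `cidx m` of the supercell motif passes the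
move test `¬MoveUnstableCore ε Rm s` and the removal test `¬RemovalUnstableCore eUp tR Rm` (e.g. by `…CollarNonExempt.not_moveUnstableCore_of_bregmanCert`
/ `not_removalUnstableCore_iff`), the cell is periodically `7/10`-separated and `cB·(r + Rm + diam) < k₀ + 1`, then NO interior site of ANY block is
`CollarCore r eUp ε Rm s tR`-exempt — the binder `hnex` of `…PeriodicBlockFlagsX.not_pairLevelLawX_of_cell_flags` with `Ex := CollarCore r eUp ε Rm s tR`.
[folklore] -/
theorem not_collarCore_block_of_classCerts {N₀ M k₀ : ℕ} {x : Fin N₀ → E3} {a b : Fin 3 → E3} {cB r Rm diam : ℝ} (hsep : PerSep x a)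
    (hdual : ∀ j k, inner ℝ (b j) (a k) = if j = k then (1 : ℝ) else 0) (hb : ∀ j, ‖b j‖ ≤ cB) (hdiam : DiamLE x diam)
    (hr : 0 ≤ r) (hk₀ : cB * (r + Rm + diam) < k₀ + 1) {μ : Fin M → Fin N₀} {σ : Fin M → Fin 3 → ℤ}
    (hσ : ∀ q k, |σ q k| ≤ k₀) (hsup : ∀ (m : Fin N₀) (s : Fin 3 → ℤ), (∀ k, |s k| ≤ k₀) → ∃ q, μ q = m ∧ σ q = s)
    (hμσ : Function.Injective fun q => (μ q, σ q)) {cidx : Fin N₀ → Fin M} (hc : ∀ m, μ (cidx m) = m ∧ σ (cidx m) = 0)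
    {eUp ε s tR : ℝ}
    (hmove : ∀ m, ¬ MoveUnstableCore ε Rm s M (superMotif x a μ σ) (cidx m))
    (hrem : ∀ m, ¬ RemovalUnstableCore eUp tR Rm M (superMotif x a μ σ) (cidx m)) :
    ∀ (n N : ℕ) (e : (Fin N₀ × (Fin 3 → Fin n)) ≃ Fin N) (m : Fin N₀) (t : Fin 3 → Fin n), Interior k₀ n t →
      ¬ CollarCore r eUp ε Rm s tR N (block x a n ∘ e.symm) (e (m, t)) := by
  intro n N e m t ht
  have hy : Function.Injective (block x a n ∘ e.symm) := (block_injective hsep n).comp e.symm.injective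
  have hz : Function.Injective (superMotif x a μ σ) := superMotif_injective hsep hμσ
  refine not_collarCore_of_forall (fun k hk => ?_) (fun k hk => ?_)
  · obtain ⟨m', w, hkw, hball, hmotif⟩ := exists_class_transport hdual hb hdiam hr hk₀ hσ hsup hc e ht (mem_ball.1 hk)
    exact fun h => hmove m' (moveUnstableCore_transport hy hz w hkw hball hmotif h)
  · obtain ⟨m', w, hkw, hball, hmotif⟩ := exists_class_transport hdual hb hdiam hr hk₀ hσ hsup hc e ht (mem_ball.1 hk)
    exact fun h => hrem m' (removalUnstableCore_transport hy hz w hkw hball hmotif h)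

end Summit.AtomisticToContinuum.Crystallization.Theorems.FrustratedLawDichotomyCollarNonExemptBlock

end
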